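import Summits.Ventures.LatticeQCDFlow.Scaling.HomLadderFreshness
import Summits.Ventures.LatticeQCDFlow.Scaling.LadderRobinModeBounds
import Summits.Ventures.LatticeQCDFlow.Scaling.HomLadderWilsonFloor

/-!
HONEST FRAMING: exact (Metropolis-corrected) sampling algorithms for lattice gauge theory; figures
of merit are autocorrelation/cost numbers at stated couplings and volumes; no continuum-physics
claim.

# HomLadderMixingCeiling — THE HOMOGENEOUS LADDER IS `Θ((K³/t)·log K)` TWO-SIDED INCLUDING THE LOGARITHM: `d(n) ≤ (1−ρ)ⁿ(K+1)/c_0 ≤ √2·K(K+1)(2K+1)·(1−ρ_*)ⁿ/t` WITH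
# `ρ_* = min{t/(K(2K+1)²), 2√2h/(π²(K+1))}`, **`t_mix(ε) ≤ ⌈max{K(2K+1)²/t, π²(K+1)/(2√2h)}·log(√2K(K+1)(2K+1)/(tε))⌉`**, AND WITH FILE 3
# **`(K(2K+1)²/(π²t) − 1)·(½·log(K+1) − log(24√5)) ≤ t_mix(1/4) ≤ ⌈max{K(2K+1)²/t, π²(K+1)/(2√2(1−t)w_0)}·log(4√2K(K+1)(2K+1)/t)⌉`** (lean-2 GEN-47, ours)

Venture-side (OURS).  Cell `lqcd-flow` (pub-lqcd), unit `pub-lqcd-lean-2-g47`, 2026-08-31.  Chapter AG, file 9 — the ceiling assembled and the two-sided law.  Setting of files 6–8: the lazy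
homogeneous ladder `P = t·T + h·R + (1−t−h)·I` (one positive law `ν` at every level, exact hot redraw `R`, every adjacent swap accepted), `K ≥ 1`, `t, h > 0`, `t + h ≤ 1`; the
weighted ladder `t·ptBareSwap ν^{⊗} + (1−t)·prodKernel w M` with idle cold kernels is the case `h = (1−t)w_0` (file 7), chapter R's `ptBareSampler` the case `h = (1−t)/(K+1)`.
ROUTE: freshness (file 8) `d(n) ≤ P(D_n ≠ ∅)`; the Robin mode of file 1 is a positive exact eigenfunction of the stale-set chain (file 6), so `P(D_n ≠ ∅) ≤ (1−ρ)ⁿ(Σ_kc_k)/c_0 ≤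
(1−ρ)ⁿ(K+1)/c_0`; file 5: `c_0 ≥ t/(√2K(2K+1))` and `ρ ≥ ρ_* = min{t/(K(2K+1)²), 2√2h/(π²(K+1))}`; `(1−ρ_*)ⁿ ≤ e^{−nρ_*}` and `ρ_*·max{1/a, 1/b} ≥ 1` give the mixing-time
ceiling, whose leading term at a hot rate `h ≳ t/K²` is `(K(2K+1)²/t)·log(K³/(tε))` — the same ORDER `(K³/t)·log K` as file 3's floor `(K(2K+1)²/(π²t))·½log K`: THE HOMOGENEOUS
LADDER (PERFECT ADJACENT TRANSPORTS) IS `Θ((K³/t)·log K)` TWO-SIDED INCLUDING THE LOGARITHM, for every content law, uniformly in the hot rate once `h ≳ t/K²`.  No definitions.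

* §1 `lazyLadder_isRowStochastic`, **`lazyLadder_worstTvDist_le_mode`** (`d(n) ≤ (1−ρ)ⁿ(K+1)/c_0` at a Robin root), **`lazyLadder_worstTvDist_le`** (`≤ √2K(K+1)(2K+1)(1−ρ_*)ⁿ/t`),
  **`lazyLadder_worstTvDist_le_of_ge_log`**, **`lazyLadder_mixingTime_le`** (`t_mix(ε) ≤ ⌈max{K(2K+1)²/t, π²(K+1)/(2√2h)}·log(√2K(K+1)(2K+1)/(tε))⌉`).
* §2 **`homLadder_mixingTime_le`** (the weighted ladder, `h = (1−t)w_0`), **`homLadder_mixingTime_two_sided`** (with file 3, `K ≥ 2`, some `ν(u) ≤ ½`), **`ptBareSampler_hom_mixingTime_le`**,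
  **`ptBareSampler_hom_mixingTime_two_sided`**.

Reading (no numerics implied): with perfect adjacent transports the replica-exchange ladder forgets any start in order `(K³/t)·log K` steps and not faster from a constant cold start: content
diffuses along the ladder (relaxation time `Θ(K³/t)`, chapter I file 14) and the last of `K+1` stale contents to be flushed out costs the logarithm (file 3's Wilson floor shows it is
real).  Against the hub (chapters L ∕ M: `Θ(K·log K)` two-sided) the ladder's topology costs exactly `K²`, maps or no maps (file 4).  NOT CLAIMED: imperfect transports (rejected swaps break
freshness; the floor survives by file 4 only for perfect ones); the cutoff window; constants (`π²·` vs `½`).  Literature grade (cell rule): OWN (chapter L's freshness route + D. B.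
Wilson's cosine mode as a Lyapunov weight); nothing cited; no new bib keys.
-/

noncomputable section

open Finset Function Real
open Literature.Probability.MarkovChains

namespace Summit.Ventures.LatticeQCDFlow.Scaling

variable {S : Type*} [Fintype S] [DecidableEq S] {K : ℕ} {ν : S → ℝ} {M : Fin (K + 1) → S → S → ℝ} {w : Fin (K + 1) → ℝ} {t h : ℝ}
  {P : (Fin (K + 1) → S) → (Fin (K + 1) → S) → ℝ}

/-! ## §1 The lazy homogeneous ladder: distance and mixing-time ceilings -/

/-- The lazy homogeneous ladder `t·T + h·R + (1−t−h)·I` is a transition matrix (`K ≥ 1`, `t, h ≥ 0`, `t + h ≤ 1`, `M_0` row-stochastic). [ours] -/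
theorem lazyLadder_isRowStochastic (hK : 1 ≤ K) (ht0 : 0 ≤ t) (hh0 : 0 ≤ h) (hth : t + h ≤ 1) (hM : ∀ k, IsRowStochastic (M k))
    (hP : ∀ x y, P x y = t * ptBareProposal x y + h * coordKernel M 0 x y + (1 - t - h) * (if y = x then 1 else 0)) : IsRowStochastic P := by
  refine ⟨fun x y => ?_, fun x => ?_⟩
  · rw [hP]
    exact add_nonneg (add_nonneg (mul_nonneg ht0 (ptBareProposal_nonneg x y)) (mul_nonneg hh0 (coordKernel_nonneg M (fun j u v => (hM j).1 u v) 0 x y)))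
      (mul_nonneg (by linarith) (by split_ifs <;> norm_num))
  · simp_rw [hP, sum_add_distrib, ← mul_sum, sum_ptBareProposal_eq_one hK, sum_coordKernel_zero_eq_one hM, sum_ite_eq' univ x, if_pos (mem_univ _)]
    ring

/-- **`d(n) ≤ (1−ρ)ⁿ·(K+1)/c_0` AT A ROBIN ROOT** (`K ≥ 1`, `t, h > 0`, `t + h ≤ 1`, `ν > 0` a probability vector, exact hot sampler, `θ` a root of the hot-end equation with rate `h`). [ours] -/
theorem lazyLadder_worstTvDist_le_mode (hK : 1 ≤ K) (ht0 : 0 < t) (hh0 : 0 < h) (hth : t + h ≤ 1) (hν : ∀ v, 0 < ν v) (hν1 : ∑ v, ν v = 1)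
    (hM : ∀ k, IsRowStochastic (M k)) (hM0 : ∀ u v, M 0 u v = ν v)
    (hP : ∀ x y, P x y = t * ptBareProposal x y + h * coordKernel M 0 x y + (1 - t - h) * (if y = x then 1 else 0))
    {θ ρ : ℝ} {c : ℕ → ℝ} (hθ0 : 0 < θ) (hθ1 : θ * (2 * K + 1) < π) (hc : ∀ n : ℕ, c n = Real.cos (θ * ((K : ℝ) + 1 / 2 - n)))
    (hρ : ρ = 2 * t / K * (1 - Real.cos θ))
    (hrobin : h * Real.cos (θ * ((K : ℝ) + 1 / 2)) = t / K * (Real.cos (θ * ((K : ℝ) + 1 / 2)) - Real.cos (θ * ((K : ℝ) + 3 / 2)))) (n : ℕ) :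
    worstTvDist P (tensorFun (fun _ : Fin (K + 1) => ν)) n ≤ (1 - ρ) ^ n * ((K : ℝ) + 1) / c 0 := by
  classical
  set Q : Finset (Fin (K + 1)) → Finset (Fin (K + 1)) → ℝ := fun D D' => (∑ j : Fin K, t / K * (if D' = D.image (levelSwap j) then (1 : ℝ) else 0))
      + h * (if D' = D.erase 0 then (1 : ℝ) else 0) + (1 - t - h) * (if D' = D then (1 : ℝ) else 0) with hQ_def
  have hQ : ∀ D D', Q D D' = (∑ j : Fin K, t / K * (if D' = D.image (levelSwap j) then (1 : ℝ) else 0))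
      + h * (if D' = D.erase 0 then (1 : ℝ) else 0) + (1 - t - h) * (if D' = D then (1 : ℝ) else 0) := fun D D' => rfl
  have hPst := lazyLadder_isRowStochastic hK ht0.le hh0.le hth hM hP
  have hfresh := ladder_worstTvDist_le_stale hK ht0.le hh0.le hth hν hν1 hM hM0 hPst hP hQ n
  have hρ0 := robinMode_rho_pos hK ht0 hθ0 hθ1 hρ
  have hρ1 : ρ ≤ 1 := ((robinMode_rho_lt hK ht0 hθ0 hθ1 hρ).2 (by linarith)).le
  have hc0 : 0 < c 0 := robinMode_c_pos hθ0 hθ1 hc (Nat.zero_le K)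
  have hstale := stale_nonempty_le hK ht0.le hh0.le hth hQ hρ0 hρ1 (robinMode_robin hc hρ hrobin) (fun m _ => robinMode_interior hc hρ m)
    (robinMode_neumann hK hc hρ) hc0 (fun k hk => robinMode_c0_le hθ0 hθ1 hc hk) (univ : Finset (Fin (K + 1))) n
  have hsum : ∑ k ∈ (univ : Finset (Fin (K + 1))), c k ≤ (K : ℝ) + 1 := robinMode_sum_le hc
  calc worstTvDist P (tensorFun (fun _ : Fin (K + 1) => ν)) n ≤ _ := hfresh
    _ ≤ (1 - ρ) ^ n * (∑ k ∈ (univ : Finset (Fin (K + 1))), c k) / c 0 := hstale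
    _ ≤ (1 - ρ) ^ n * ((K : ℝ) + 1) / c 0 := by gcongr

/-- **`d(n) ≤ √2·K(K+1)(2K+1)·(1−ρ_*)ⁿ/t`**, `ρ_* = min{t/(K(2K+1)²), 2√2h/(π²(K+1))}` — for EVERY `n` (the Robin root eliminated by file 5's lower bounds). [ours] -/
theorem lazyLadder_worstTvDist_le (hK : 1 ≤ K) (ht0 : 0 < t) (hh0 : 0 < h) (hth : t + h ≤ 1) (hν : ∀ v, 0 < ν v) (hν1 : ∑ v, ν v = 1)
    (hM : ∀ k, IsRowStochastic (M k)) (hM0 : ∀ u v, M 0 u v = ν v)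
    (hP : ∀ x y, P x y = t * ptBareProposal x y + h * coordKernel M 0 x y + (1 - t - h) * (if y = x then 1 else 0)) (n : ℕ) :
    worstTvDist P (tensorFun (fun _ : Fin (K + 1) => ν)) n
      ≤ Real.sqrt 2 * K * ((K : ℝ) + 1) * (2 * K + 1) / t * (1 - min (t / ((K : ℝ) * (2 * K + 1) ^ 2)) (2 * Real.sqrt 2 * h / (π ^ 2 * ((K : ℝ) + 1)))) ^ n := by
  have hKpos : (0 : ℝ) < K := Nat.cast_pos.mpr (by omega)
  obtain ⟨θ, hθ0, hθ1, hrobin⟩ := robinMode_exists (t := t) (h := h) hK ht0 hh0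
  set ρ : ℝ := 2 * t / K * (1 - Real.cos θ) with hρ
  set c : ℕ → ℝ := fun n => Real.cos (θ * ((K : ℝ) + 1 / 2 - n)) with hc_def
  have hc : ∀ n : ℕ, c n = Real.cos (θ * ((K : ℝ) + 1 / 2 - n)) := fun n => rfl
  have h1 := lazyLadder_worstTvDist_le_mode hK ht0 hh0 hth hν hν1 hM hM0 hP hθ0 hθ1 hc hρ hrobin n
  have hρ1 : ρ ≤ 1 := ((robinMode_rho_lt hK ht0 hθ0 hθ1 hρ).2 (by linarith)).le
  have hc0 : 0 < c 0 := robinMode_c_pos hθ0 hθ1 hc (Nat.zero_le K)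
  have hc0ge := robinMode_c0_ge hK ht0 (by linarith) (by linarith) hθ0 hθ1 hc hrobin
  have hρmin := robinMode_rho_ge_min hK ht0 hh0.le hθ0 hθ1 hc hρ hrobin
  set ρs : ℝ := min (t / ((K : ℝ) * (2 * K + 1) ^ 2)) (2 * Real.sqrt 2 * h / (π ^ 2 * ((K : ℝ) + 1))) with hρs
  have hρs0 : 0 < ρs := lt_min (by positivity) (by positivity)
  -- `(1−ρ)ⁿ ≤ (1−ρ_*)ⁿ` and `(K+1)/c_0 ≤ √2K(K+1)(2K+1)/t`
  have hpow : (1 - ρ) ^ n ≤ (1 - ρs) ^ n := pow_le_pow_left₀ (by linarith) (by linarith) n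
  have hfrac : ((K : ℝ) + 1) / c 0 ≤ Real.sqrt 2 * K * ((K : ℝ) + 1) * (2 * K + 1) / t := by
    rw [div_le_div_iff₀ hc0 ht0]; nlinarith
  calc worstTvDist P (tensorFun (fun _ : Fin (K + 1) => ν)) n ≤ (1 - ρ) ^ n * ((K : ℝ) + 1) / c 0 := h1
    _ = (1 - ρ) ^ n * (((K : ℝ) + 1) / c 0) := by ring
    _ ≤ (1 - ρs) ^ n * (Real.sqrt 2 * K * ((K : ℝ) + 1) * (2 * K + 1) / t) :=
        mul_le_mul hpow hfrac (div_nonneg (by positivity) hc0.le) (pow_nonneg (by linarith) n)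
    _ = _ := by ring

/-- **`n ≥ max{K(2K+1)²/t, π²(K+1)/(2√2h)}·log(√2K(K+1)(2K+1)/(tε))` ⇒ `d(n) ≤ ε`.** [ours] -/
theorem lazyLadder_worstTvDist_le_of_ge_log (hK : 1 ≤ K) (ht0 : 0 < t) (hh0 : 0 < h) (hth : t + h ≤ 1) (hν : ∀ v, 0 < ν v) (hν1 : ∑ v, ν v = 1)
    (hM : ∀ k, IsRowStochastic (M k)) (hM0 : ∀ u v, M 0 u v = ν v)
    (hP : ∀ x y, P x y = t * ptBareProposal x y + h * coordKernel M 0 x y + (1 - t - h) * (if y = x then 1 else 0)) {ε : ℝ} (hε : 0 < ε) {n : ℕ}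
    (hn : max ((K : ℝ) * (2 * K + 1) ^ 2 / t) (π ^ 2 * ((K : ℝ) + 1) / (2 * Real.sqrt 2 * h)) * Real.log (Real.sqrt 2 * K * ((K : ℝ) + 1) * (2 * K + 1) / (t * ε)) ≤ n) :
    worstTvDist P (tensorFun (fun _ : Fin (K + 1) => ν)) n ≤ ε := by
  have hKpos : (0 : ℝ) < K := Nat.cast_pos.mpr (by omega)
  have hs2 : 0 < Real.sqrt 2 := Real.sqrt_pos.mpr (by norm_num)
  set A : ℝ := Real.sqrt 2 * K * ((K : ℝ) + 1) * (2 * K + 1) / t with hA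
  have hA0 : 0 < A := by rw [hA]; positivity
  set a1 : ℝ := t / ((K : ℝ) * (2 * K + 1) ^ 2) with ha1
  set a2 : ℝ := 2 * Real.sqrt 2 * h / (π ^ 2 * ((K : ℝ) + 1)) with ha2
  have ha10 : 0 < a1 := by rw [ha1]; positivity
  have ha20 : 0 < a2 := by rw [ha2]; positivity
  set ρs : ℝ := min a1 a2 with hρs
  have hρs0 : 0 < ρs := lt_min ha10 ha20
  have hρs1 : ρs ≤ 1 := by
    refine le_trans (min_le_left _ _) ?_
    rw [ha1, div_le_one (by positivity)]
    have hK1 : (1 : ℝ) ≤ K := by exact_mod_cast hK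
    nlinarith [hth, hh0]
  have h1 := lazyLadder_worstTvDist_le hK ht0 hh0 hth hν hν1 hM hM0 hP n
  -- `max{1/a1, 1/a2}·ρ_* ≥ 1`
  have hinv : max ((K : ℝ) * (2 * K + 1) ^ 2 / t) (π ^ 2 * ((K : ℝ) + 1) / (2 * Real.sqrt 2 * h)) = max (1 / a1) (1 / a2) := by
    rw [ha1, ha2, one_div_div, one_div_div]
  have hprod : 1 ≤ max (1 / a1) (1 / a2) * ρs := by
    rcases le_total a1 a2 with h12 | h12
    · rw [hρs, min_eq_left h12]
      calc (1 : ℝ) = 1 / a1 * a1 := by field_simp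
        _ ≤ max (1 / a1) (1 / a2) * a1 := mul_le_mul_of_nonneg_right (le_max_left _ _) ha10.le
    · rw [hρs, min_eq_right h12]
      calc (1 : ℝ) = 1 / a2 * a2 := by field_simp
        _ ≤ max (1 / a1) (1 / a2) * a2 := mul_le_mul_of_nonneg_right (le_max_right _ _) ha20.le
  -- the exponent beats `log(A/ε)`
  set L : ℝ := Real.log (A / ε) with hL
  have hAε : Real.sqrt 2 * K * ((K : ℝ) + 1) * (2 * K + 1) / (t * ε) = A / ε := by rw [hA]; field_simp
  rw [hAε, hinv] at hn
  have hexp : Real.exp (-(n * ρs)) ≤ ε / A := by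
    have hεA : Real.exp (-L) = ε / A := by rw [hL, Real.exp_neg, Real.exp_log (by positivity), inv_div]
    rw [← hεA]
    refine Real.exp_le_exp.mpr (neg_le_neg ?_)
    by_cases hL0 : 0 ≤ L
    · have := mul_le_mul_of_nonneg_right hn hρs0.le
      calc L ≤ max (1 / a1) (1 / a2) * ρs * L := le_mul_of_one_le_left hL0 hprod
        _ = max (1 / a1) (1 / a2) * L * ρs := by ring
        _ ≤ n * ρs := this
    · push Not at hL0
      exact le_trans hL0.le (by positivity)
  have hpow : (1 - ρs) ^ n ≤ Real.exp (-(n * ρs)) := by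
    calc (1 - ρs) ^ n ≤ (Real.exp (-ρs)) ^ n := by
          apply pow_le_pow_left₀ (by linarith)
          have := Real.add_one_le_exp (-ρs); linarith
      _ = Real.exp (-(n * ρs)) := by rw [← Real.exp_nat_mul]; ring_nf
  calc worstTvDist P (tensorFun (fun _ : Fin (K + 1) => ν)) n ≤ A * (1 - ρs) ^ n := h1
    _ ≤ A * (ε / A) := mul_le_mul_of_nonneg_left (hpow.trans hexp) hA0.le
    _ = ε := by field_simp

/-- **THE CEILING: `t_mix(ε) ≤ ⌈max{K(2K+1)²/t, π²(K+1)/(2√2h)}·log(√2K(K+1)(2K+1)/(tε))⌉`** for the lazy homogeneous ladder. [ours] -/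
theorem lazyLadder_mixingTime_le (hK : 1 ≤ K) (ht0 : 0 < t) (hh0 : 0 < h) (hth : t + h ≤ 1) (hν : ∀ v, 0 < ν v) (hν1 : ∑ v, ν v = 1)
    (hM : ∀ k, IsRowStochastic (M k)) (hM0 : ∀ u v, M 0 u v = ν v)
    (hP : ∀ x y, P x y = t * ptBareProposal x y + h * coordKernel M 0 x y + (1 - t - h) * (if y = x then 1 else 0)) {ε : ℝ} (hε : 0 < ε) :
    mixingTime P (tensorFun (fun _ : Fin (K + 1) => ν)) ε
      ≤ ⌈max ((K : ℝ) * (2 * K + 1) ^ 2 / t) (π ^ 2 * ((K : ℝ) + 1) / (2 * Real.sqrt 2 * h)) * Real.log (Real.sqrt 2 * K * ((K : ℝ) + 1) * (2 * K + 1) / (t * ε))⌉₊ :=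
  mixingTime_le _ _ (lazyLadder_worstTvDist_le_of_ge_log hK ht0 hh0 hth hν hν1 hM hM0 hP hε (Nat.le_ceil _))

/-! ## §2 The weighted ladder and chapter R's sampler: the two-sided `K³·log K` law -/

section Weighted
variable {P' : (Fin (K + 1) → S) → (Fin (K + 1) → S) → ℝ}

/-- **THE CEILING FOR THE WEIGHTED HOMOGENEOUS LADDER** (`K ≥ 1`, `0 < t < 1`, `w` a probability vector with `w_0 > 0`, `ν > 0` a probability vector, exact hot sampler, idle cold kernels):
**`t_mix(ε) ≤ ⌈max{K(2K+1)²/t, π²(K+1)/(2√2(1−t)w_0)}·log(√2K(K+1)(2K+1)/(tε))⌉`**. [ours] -/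
theorem homLadder_mixingTime_le (hK : 1 ≤ K) (ht0 : 0 < t) (ht1 : t < 1) (hν : ∀ v, 0 < ν v) (hν1 : ∑ v, ν v = 1) (hM0 : ∀ u v, M 0 u v = ν v)
    (hidle : ∀ i : Fin K, ∀ u v, M i.succ u v = if v = u then 1 else 0) (hw0 : ∀ k, 0 ≤ w k) (hw00 : 0 < w 0) (hw1 : ∑ k, w k = 1)
    (hP' : ∀ x y, P' x y = t * ptBareSwap (fun _ : Fin (K + 1) => ν) x y + (1 - t) * prodKernel w M x y) {ε : ℝ} (hε : 0 < ε) :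
    mixingTime P' (tensorFun (fun _ : Fin (K + 1) => ν)) ε
      ≤ ⌈max ((K : ℝ) * (2 * K + 1) ^ 2 / t) (π ^ 2 * ((K : ℝ) + 1) / (2 * Real.sqrt 2 * ((1 - t) * w 0)))
          * Real.log (Real.sqrt 2 * K * ((K : ℝ) + 1) * (2 * K + 1) / (t * ε))⌉₊ := by
  have hM := (homLadder_kernels hν hν1 hM0 hidle).1
  have hw01 : w 0 ≤ 1 := by
    calc w 0 ≤ ∑ k, w k := Finset.single_le_sum (fun k _ => hw0 k) (mem_univ 0)
      _ = 1 := hw1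
  have hP : ∀ x y, P' x y = t * ptBareProposal x y + (1 - t) * w 0 * coordKernel M 0 x y + (1 - t - (1 - t) * w 0) * (if y = x then 1 else 0) :=
    fun x y => by rw [hP', homLadder_lazyForm hK hν hidle hw1]
  exact lazyLadder_mixingTime_le (h := (1 - t) * w 0) hK ht0 (mul_pos (by linarith) hw00) (by nlinarith) hν hν1 hM hM0 hP hε

/-- **THE HOMOGENEOUS LADDER IS `Θ((K³/t)·log K)`, BOTH SIDES IN ONE STATEMENT:** `K ≥ 2`, `0 < t < 1`, `w` a probability vector with `w_0 > 0`, one positive law `ν` with some `ν(u) ≤ ½`,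
exact hot sampler, idle cold kernels:
**`(K(2K+1)²/(π²t) − 1)·(½·log(K+1) − log(24√5)) ≤ t_mix(1/4) ≤ ⌈max{K(2K+1)²/t, π²(K+1)/(2√2(1−t)w_0)}·log(4√2K(K+1)(2K+1)/t)⌉`**. [ours] -/
theorem homLadder_mixingTime_two_sided (hK : 2 ≤ K) (ht0 : 0 < t) (ht1 : t < 1) (hν : ∀ v, 0 < ν v) (hν1 : ∑ v, ν v = 1) (hM0 : ∀ u v, M 0 u v = ν v)
    (hidle : ∀ i : Fin K, ∀ u v, M i.succ u v = if v = u then 1 else 0) (hw0 : ∀ k, 0 ≤ w k) (hw00 : 0 < w 0) (hw1 : ∑ k, w k = 1)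
    (hP' : ∀ x y, P' x y = t * ptBareSwap (fun _ : Fin (K + 1) => ν) x y + (1 - t) * prodKernel w M x y) (u : S) (hu : ν u ≤ 1 / 2) :
    ((K : ℝ) * (2 * K + 1) ^ 2 / (π ^ 2 * t) - 1) * (Real.log ((K : ℝ) + 1) / 2 - Real.log (24 * Real.sqrt 5))
        ≤ (mixingTime P' (tensorFun (fun _ : Fin (K + 1) => ν)) (1 / 4) : ℝ)
      ∧ mixingTime P' (tensorFun (fun _ : Fin (K + 1) => ν)) (1 / 4)
        ≤ ⌈max ((K : ℝ) * (2 * K + 1) ^ 2 / t) (π ^ 2 * ((K : ℝ) + 1) / (2 * Real.sqrt 2 * ((1 - t) * w 0)))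
            * Real.log (Real.sqrt 2 * K * ((K : ℝ) + 1) * (2 * K + 1) / (t * (1 / 4)))⌉₊ :=
  ⟨homLadder_mixingTime_ge hK hν hν1 hM0 hidle hw0 hw00 hw1 ht0 ht1 hP' u hu,
    homLadder_mixingTime_le (by omega) ht0 ht1 hν hν1 hM0 hidle hw0 hw00 hw1 hP' (by norm_num)⟩

end Weighted

/-- **THE CEILING FOR CHAPTER R'S SAMPLER `ptBareSampler t ν^{⊗} M`** (uniform update weights; hot rate `(1−t)/(K+1)`):
`t_mix(ε) ≤ ⌈max{K(2K+1)²/t, π²(K+1)/(2√2(1−t)/(K+1))}·log(√2K(K+1)(2K+1)/(tε))⌉`. [ours] -/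
theorem ptBareSampler_hom_mixingTime_le (hK : 1 ≤ K) (ht0 : 0 < t) (ht1 : t < 1) (hν : ∀ v, 0 < ν v) (hν1 : ∑ v, ν v = 1) (hM0 : ∀ u v, M 0 u v = ν v)
    (hidle : ∀ i : Fin K, ∀ u v, M i.succ u v = if v = u then 1 else 0) {ε : ℝ} (hε : 0 < ε) :
    mixingTime (ptBareSampler t (fun _ : Fin (K + 1) => ν) M) (tensorFun (fun _ : Fin (K + 1) => ν)) ε
      ≤ ⌈max ((K : ℝ) * (2 * K + 1) ^ 2 / t) (π ^ 2 * ((K : ℝ) + 1) / (2 * Real.sqrt 2 * ((1 - t) * ((1 : ℝ) / (K + 1)))))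
          * Real.log (Real.sqrt 2 * K * ((K : ℝ) + 1) * (2 * K + 1) / (t * ε))⌉₊ :=
  homLadder_mixingTime_le (w := fun _ : Fin (K + 1) => (1 : ℝ) / (K + 1)) hK ht0 ht1 hν hν1 hM0 hidle (fun _ => by positivity) (by positivity)
    (sum_uniform_weight K) (fun x y => ptBareSampler_apply t _ M x y) hε

/-- **CHAPTER R'S HOMOGENEOUS LADDER IS `Θ((K³/t)·log K)`, BOTH SIDES** (`K ≥ 2`, `0 < t < 1`, exact hot sampler, idle cold kernels, some `ν(u) ≤ ½`). [ours] -/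
theorem ptBareSampler_hom_mixingTime_two_sided (hK : 2 ≤ K) (ht0 : 0 < t) (ht1 : t < 1) (hν : ∀ v, 0 < ν v) (hν1 : ∑ v, ν v = 1) (hM0 : ∀ u v, M 0 u v = ν v)
    (hidle : ∀ i : Fin K, ∀ u v, M i.succ u v = if v = u then 1 else 0) (u : S) (hu : ν u ≤ 1 / 2) :
    ((K : ℝ) * (2 * K + 1) ^ 2 / (π ^ 2 * t) - 1) * (Real.log ((K : ℝ) + 1) / 2 - Real.log (24 * Real.sqrt 5))
        ≤ (mixingTime (ptBareSampler t (fun _ : Fin (K + 1) => ν) M) (tensorFun (fun _ : Fin (K + 1) => ν)) (1 / 4) : ℝ)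
      ∧ mixingTime (ptBareSampler t (fun _ : Fin (K + 1) => ν) M) (tensorFun (fun _ : Fin (K + 1) => ν)) (1 / 4)
        ≤ ⌈max ((K : ℝ) * (2 * K + 1) ^ 2 / t) (π ^ 2 * ((K : ℝ) + 1) / (2 * Real.sqrt 2 * ((1 - t) * ((1 : ℝ) / (K + 1)))))
            * Real.log (Real.sqrt 2 * K * ((K : ℝ) + 1) * (2 * K + 1) / (t * (1 / 4)))⌉₊ :=
  ⟨ptBareSampler_hom_mixingTime_ge hK hν hν1 hM0 hidle ht0 ht1 u hu,
    ptBareSampler_hom_mixingTime_le (by omega) ht0 ht1 hν hν1 hM0 hidle (by norm_num)⟩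

end Summit.Ventures.LatticeQCDFlow.Scaling

end
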